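import Mathlib
import HarnessLib
import Summits.ValiantsHypothesis.ValiantsHypothesis.Theorems.MonotoneRestorationOrbitRestorationLinearVolumeQPImpliesVH
import Summits.ValiantsHypothesis.ValiantsHypothesis.Theorems.MonotoneRestorationOrbitRestorationLinearVolumeQPNarrow

/-!
# The open stub `stub_lvNarrowSpan` of line `birth` is VH-strength: linear-volume narrow span ⇒ VP ≠ VNP

Route MonotoneRestoration, aside R1 = `OrbitRestorationLinearVolumeQP` (stmt-ValiantsHypothesis-18294), line `birth`
(K2/K3 closed by name, `…LinearVolumeQPBirthStubs.lean`; the item rests on `stub_lvNarrowSpan : LvNarrowSpan`).  Composing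
the landed reduction `OrbitRestorationLinearVolumeQPNarrow.orbitRestorationLinearVolumeQP_of_lvNarrowSpan` (R1 from the
linear-volume narrow-span statement alone) with `valiantsHypothesis_of_orbitRestorationLinearVolumeQP` (R1 decides the
summit, unconditionally):

* `valiantsHypothesis_of_lvNarrowSpan` — if every `VP` family of R1's class lies, for one constant and every level, in
  the ℂ-span of the homomorphism polynomials of bipartite patterns of treewidth `≤ (log₂ n + c)^c` (the statement of
  `stub_lvNarrowSpan`, spelled out verbatim as in `…LinearVolumeQPNarrow.lean`), then `VP ≠ VNP` over `ℂ`;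
* `valiantsHypothesis_of_lvNarrowExpressions` — the same from the expression form (closed labelled pattern expressions
  with `(log₂ n + c)^c` labels a side, any length).

Honest framing: a two-line composition recording that the last open stub of the line — Dwivedi–Pago–Seppelt's Outlook Q3
at quasi-polynomial scale for the linear-volume class — is at least as strong as Valiant's hypothesis.  Nothing is proved
about the stub, R1, the crux or VP ≠ VNP.
-/

noncomputable section

-- `Summit.ValiantsHypothesis.ValiantsHypothesis.…` is the tree's single-conjunct layout (Sub = Summit).
set_option linter.dupNamespace false

namespace Summit.ValiantsHypothesis.ValiantsHypothesis.Theorems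

namespace OrbitRestorationLinearVolumeQPVHStrength

open Summit.ValiantsHypothesis.ValiantsHypothesis.Theses.MonotoneRestoration
open Literature.Computability.AlgebraicComplexity

/-- **Linear-volume narrow span ⇒ VP ≠ VNP**: the statement of the open stub `stub_lvNarrowSpan` (every `VP` family of
R1's class lies level by level in the span of hom polynomials of patterns of polylog treewidth) implies Valiant's
hypothesis over `ℂ`. [cite: DwivediPagoSeppelt2026, Outlook Q3; DawarWilsenach2025, Thm 7.2] -/
theorem valiantsHypothesis_of_lvNarrowSpan
    (h : ∀ f : (n : ℕ) → MvPolynomial (Fin n × Fin n) ℂ, IsVPFamily f →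
      (∃ (c : ℕ) (m : ℕ → ℕ) (a b : (n : ℕ) → Fin (m n) → ℕ)
          (E : (n : ℕ) → (i : Fin (m n)) → Multiset (Fin (a n i) × Fin (b n i)))
          (α : (n : ℕ) → Fin (m n) → ℂ),
        (∀ n, m n ≤ (n + 2) ^ c) ∧ (∀ n i, a n i + b n i ≤ c * (n + 1)) ∧
          ∀ n, f n = ∑ i : Fin (m n), MvPolynomial.C (α n i) * homPoly (E n i) n ℂ) →
      ∃ c : ℕ, ∀ n : ℕ, f n ∈ Submodule.span ℂ
        {p : MvPolynomial (Fin n × Fin n) ℂ | ∃ (a b : ℕ) (E : Multiset (Fin a × Fin b)),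
          Literature.Combinatorics.SimpleGraph.treewidth
              (SimpleGraph.fromRel fun u v : Fin a ⊕ Fin b =>
                ∃ e ∈ E, u = Sum.inl e.1 ∧ v = Sum.inr e.2) ≤ (Nat.log 2 n + c) ^ c ∧
            p = homPoly E n ℂ}) :
    ValiantsHypothesis :=
  valiantsHypothesis_of_orbitRestorationLinearVolumeQP
    (OrbitRestorationLinearVolumeQPNarrow.orbitRestorationLinearVolumeQP_of_lvNarrowSpan h)

/-- **Linear-volume narrow expressions ⇒ VP ≠ VNP**: if every `VP` family of R1's class is, for one constant and every
`n ≥ 1`, the closed polynomial of some labelled pattern expression with `(log₂ n + c)^c` row and column labels (any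
length), then Valiant's hypothesis holds over `ℂ`. [cite: DwivediPagoSeppelt2026, Outlook Q3; DawarWilsenach2025, Thm 7.2] -/
theorem valiantsHypothesis_of_lvNarrowExpressions
    (h : ∀ f : (n : ℕ) → MvPolynomial (Fin n × Fin n) ℂ, IsVPFamily f →
      (∃ (c : ℕ) (m : ℕ → ℕ) (a b : (n : ℕ) → Fin (m n) → ℕ)
          (E : (n : ℕ) → (i : Fin (m n)) → Multiset (Fin (a n i) × Fin (b n i)))
          (α : (n : ℕ) → Fin (m n) → ℂ),
        (∀ n, m n ≤ (n + 2) ^ c) ∧ (∀ n i, a n i + b n i ≤ c * (n + 1)) ∧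
          ∀ n, f n = ∑ i : Fin (m n), MvPolynomial.C (α n i) * homPoly (E n i) n ℂ) →
      ∃ c : ℕ, ∀ n : ℕ, 1 ≤ n →
        ∃ e : PatternExpr ℂ ((Nat.log 2 n + c) ^ c) ((Nat.log 2 n + c) ^ c), e.close n = f n) :
    ValiantsHypothesis :=
  valiantsHypothesis_of_orbitRestorationLinearVolumeQP
    (OrbitRestorationLinearVolumeQPNarrow.orbitRestorationLinearVolumeQP_of_lvNarrowExpressions h)

end OrbitRestorationLinearVolumeQPVHStrength

end Summit.ValiantsHypothesis.ValiantsHypothesis.Theorems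

end
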